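import Literature.NumberTheory.PAdicHodge.TateAlmostEtaleTorsion
import Literature.NumberTheory.PAdicHodge.TateAlmostEtaleMonogenic
import Mathlib.FieldTheory.Galois.Infinite
import Mathlib.NumberTheory.Cyclotomic.Basic
import HarnessLib

/-!
# Tate's almost étale lemma — the local form over `F_∞` (Tate 1967 §3.2 Prop. 9 / (3.3))

`F` a `p`-adic field (`CharZero`, residue characteristic `p`), `F̄` its normed algebraic closure,
`Γ_F = Gal(F̄/F)`, `Γ_{F_∞} = χ⁻¹(μ(ℤ_p)) ≤ Γ_F` the group of the cyclotomic `ℤ_p`-extension `F_∞/F`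
(`χ` the cyclotomic character).  **For every open subgroup `N ≤ Γ_F` and every `ρ < 1` there is an
integral `y ∈ F̄` fixed by `N ∩ Γ_{F_∞}` whose trace `Σ_{Γ_{F_∞}/(N ∩ Γ_{F_∞})} σ y` has absolute value
`> ρ`** (`exists_integral_fixed_norm_orbitSum_gt`): the trace map of every finite extension of `F_∞`
inside `F̄` is almost surjective on integers — Tate's "`F_∞` is deeply ramified".

Proof: `M = F̄^N` (finite over `F`, Galois correspondence for the open subgroup `N`), `E` the normal
closure of `M` over `K₀ = ℚ_p` with integral primitive element `y₀`, `Ω_n = E(ζ_{p^n})`; the layer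
theorem `exists_integral_fixed_norm_orbitSum_ge` (monogenic integral generator, Serre IV §1 Prop. 3
in norm form, cyclotomic orbit sums) applied with `A, B` the images of `Γ_{F_∞}`, `N ∩ Γ_{F_∞}` in
`Gal(Ω_n/K₀)` and `λ` from `exists_fixed_norm_between`, for `n` large; the coset sums over
`Γ_{F_∞}/(N ∩ Γ_{F_∞})` and `A/B` agree because `ker(Γ_F → Gal(Ω_n/K₀)) ∩ Γ_{F_∞} ≤ N` (`Ω_n ⊇ M`).
No `sorry`, no definitions.

References: J. Tate, *p-divisible groups* (1967) §3.2 Prop. 9, §3.3 [Tate1967]; J.-P. Serre,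
*Local Fields* Ch. IV [SerreLocalFields1979]; J. Coates, R. Greenberg, *Kummer theory for abelian
varieties over local fields* (1996) §2 (deeply ramified extensions) [CoatesGreenberg1996].
-/

noncomputable section

open scoped Classical
open Polynomial Finset IntermediateField Field

namespace Literature.NumberTheory.PAdicHodge.TateAlmostEtale

open ValuativeRel CyclotomicTower BaseGaloisGroup
open Literature.NumberTheory.GaloisRepresentations
open Literature.NumberTheory.GaloisRepresentations.IsNonarchimedeanLocalField

/-! ## Transfer of coset sums along a homomorphism -/

/-- Coset sums transfer along `r : Γ → G`: with `A = r(Γ')`, `B = r(N ∩ Γ')` and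
`ker r ∩ Γ' ≤ N`, the map `Γ'/(N ∩ Γ') → A/B` is a bijection, so `Σ_{q ∈ Γ'/(N∩Γ')} f(r q) =
Σ_{s ∈ A/B} f(s)` for `f` right-invariant under `B`. Auxiliary. [folklore] -/
private theorem sum_quotient_eq_sum_quotient_map {Γ G : Type*} [Group Γ] [Group G] (r : Γ →* G)
    (GF N : Subgroup Γ) (A B : Subgroup G) (hA : A = GF.map r) (hB : B = (N ⊓ GF).map r)
    [Fintype (GF ⧸ N.subgroupOf GF)] [Fintype (A ⧸ B.subgroupOf A)]
    (hker : ∀ u ∈ GF, r u = 1 → u ∈ N) {M : Type*} [AddCommMonoid M] (f : G → M)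
    (hf : ∀ b ∈ B, ∀ g : G, f (g * b) = f g) :
    ∑ q : GF ⧸ N.subgroupOf GF, f (r ((q.out : GF) : Γ)) =
      ∑ s : A ⧸ B.subgroupOf A, f ((s.out : A) : G) := by
  have hmemA : ∀ g : GF, r (g : Γ) ∈ A := fun g => by
    rw [hA]; exact Subgroup.mem_map_of_mem r g.2
  set φ : GF ⧸ N.subgroupOf GF → A ⧸ B.subgroupOf A :=
    fun q => QuotientGroup.mk ⟨r ((q.out : GF) : Γ), hmemA q.out⟩ with hφ
  -- summands agree
  have hval : ∀ q : GF ⧸ N.subgroupOf GF, f (r ((q.out : GF) : Γ)) = f (((φ q).out : A) : G) := by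
    intro q
    obtain ⟨b, hb⟩ := QuotientGroup.mk_out_eq_mul (B.subgroupOf A) (⟨r ((q.out : GF) : Γ), hmemA q.out⟩ : A)
    have hbB : ((b : A) : G) ∈ B := by
      have := b.2; rwa [Subgroup.mem_subgroupOf] at this
    change f (r ((q.out : GF) : Γ)) = f (((QuotientGroup.mk (⟨r ((q.out : GF) : Γ), hmemA q.out⟩ : A) :
      A ⧸ B.subgroupOf A).out : A) : G)
    rw [hb, Subgroup.coe_mul, hf _ hbB]
  -- injective
  have hinj : Function.Injective φ := by
    intro q₁ q₂ h
    have h1 := QuotientGroup.eq.mp h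
    rw [Subgroup.mem_subgroupOf, Subgroup.coe_mul, Subgroup.coe_inv] at h1
    change (r ((q₁.out : GF) : Γ))⁻¹ * r ((q₂.out : GF) : Γ) ∈ B at h1
    rw [← map_inv, ← map_mul, hB, Subgroup.mem_map] at h1
    obtain ⟨v, hv, hrv⟩ := h1
    rw [Subgroup.mem_inf] at hv
    set w : Γ := ((q₁.out : GF) : Γ)⁻¹ * ((q₂.out : GF) : Γ) with hw
    have hwGF : w ∈ GF := GF.mul_mem (GF.inv_mem q₁.out.2) q₂.out.2
    have hu : w * v⁻¹ ∈ N := by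
      refine hker _ (GF.mul_mem hwGF (GF.inv_mem hv.2)) ?_
      rw [map_mul, map_inv, hrv, mul_inv_cancel]
    have hwN : w ∈ N := by
      have := N.mul_mem hu hv.1
      rwa [inv_mul_cancel_right] at this
    have hmem : (q₁.out)⁻¹ * q₂.out ∈ N.subgroupOf GF := by
      rw [Subgroup.mem_subgroupOf]; exact hwN
    have := QuotientGroup.eq.mpr hmem
    rwa [QuotientGroup.out_eq', QuotientGroup.out_eq'] at this
  -- surjective
  have hsurj : Function.Surjective φ := by
    intro s
    have hs : ((s.out : A) : G) ∈ GF.map r := by rw [← hA]; exact s.out.2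
    obtain ⟨g, hg, hrg⟩ := Subgroup.mem_map.mp hs
    refine ⟨QuotientGroup.mk ⟨g, hg⟩, ?_⟩
    obtain ⟨n₀, hn₀⟩ := QuotientGroup.mk_out_eq_mul (N.subgroupOf GF) (⟨g, hg⟩ : GF)
    have hn₀N : ((n₀ : GF) : Γ) ∈ N ⊓ GF := by
      rw [Subgroup.mem_inf]
      have := n₀.2; rw [Subgroup.mem_subgroupOf] at this
      exact ⟨this, (n₀ : GF).2⟩
    rw [hφ]
    dsimp only
    rw [← QuotientGroup.out_eq' s]
    apply QuotientGroup.eq.mpr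
    rw [Subgroup.mem_subgroupOf, Subgroup.coe_mul, Subgroup.coe_inv]
    change (r (((QuotientGroup.mk (⟨g, hg⟩ : GF) : GF ⧸ N.subgroupOf GF).out : GF) : Γ))⁻¹ *
      ((s.out : A) : G) ∈ B
    rw [hn₀, Subgroup.coe_mul, map_mul]
    change (r g * r ((n₀ : GF) : Γ))⁻¹ * ((s.out : A) : G) ∈ B
    rw [hrg, mul_inv_rev, mul_assoc, inv_mul_cancel, mul_one, hB]
    exact Subgroup.inv_mem _ (Subgroup.mem_map_of_mem r hn₀N)
  exact Fintype.sum_bijective φ ⟨hinj, hsurj⟩ (fun q => f (r ((q.out : GF) : Γ)))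
    (fun s => f ((s.out : A) : G)) hval

/-! ## The local form of Tate's lemma -/

variable {F : Type} [Field F] [ValuativeRel F] [TopologicalSpace F] [IsNonarchimedeanLocalField F]
  [CharZero F] {p : ℕ} [Fact p.Prime] (hp : valuation F p < 1)

/-- `φ(p^k) ≥ k`. Auxiliary. [folklore] -/
private theorem le_totient_prime_pow (k : ℕ) : k ≤ (p ^ k).totient := by
  have hp' : p.Prime := Fact.out
  rcases Nat.eq_zero_or_pos k with rfl | hk
  · exact Nat.zero_le _
  rw [Nat.totient_prime_pow hp' hk]
  have h1 : k ≤ p ^ (k - 1) := by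
    have := Nat.lt_pow_self hp'.one_lt (n := k - 1)
    omega
  calc k ≤ p ^ (k - 1) := h1
    _ ≤ p ^ (k - 1) * (p - 1) := Nat.le_mul_of_pos_right _ (by have := hp'.two_le; omega)

/-- **Tate's almost étale lemma over `F_∞` (local form of Tate 1967 §3.2 Prop. 9 / §3.3, "`F_∞/F` is
deeply ramified").**  Let `Γ' ≤ Γ_F` be the subgroup of those `σ` whose cyclotomic character is a
root of unity (`= Gal(F̄/F_∞)`, `F_∞` the cyclotomic `ℤ_p`-extension of `F`).  For every open subgroup
`N ≤ Γ_F` with `Γ'/(N ∩ Γ')` finite and every `ρ < 1` there is `y ∈ F̄` with `‖y‖ ≤ 1`, fixed by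
`N ∩ Γ'`, and `ρ < ‖Σ_{q ∈ Γ'/(N ∩ Γ')} q·y‖`.
[cite: Tate1967, §3.2 Prop. 9 and §3.3] [cite: CoatesGreenberg1996, §2 (Thm. 2.13)] -/
theorem exists_integral_fixed_norm_orbitSum_gt (GF : Subgroup (absoluteGaloisGroup F))
    (hGF : ∀ σ, σ ∈ GF ↔ IsOfFinOrder (baseCyclotomicCharacter hp (BaseGaloisGroup.toBase hp σ)))
    (N : Subgroup (absoluteGaloisGroup F)) (hNo : IsOpen (N : Set (absoluteGaloisGroup F)))
    [Fintype (GF ⧸ N.subgroupOf GF)] {ρ : ℝ} (hρ : ρ < 1) :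
    ∃ y : NormedAlgClosure F, ‖y‖ ≤ 1 ∧ (∀ u ∈ N ⊓ GF, u • y = y) ∧
      ρ < ‖∑ q : GF ⧸ N.subgroupOf GF, ((q.out : GF) : absoluteGaloisGroup F) • y‖ := by
  have hp' : p.Prime := Fact.out
  set K₀ := PadicBase F p hp with hK₀
  set t : ℝ := ‖(p : PadicBase F p hp)‖ with ht
  have ht0 : 0 < t := PadicBase.norm_p_pos hp
  have ht1 : t < 1 := PadicBase.norm_p_lt_one hp
  -- WLOG `1/2 ≤ ρ`
  set ρ₁ : ℝ := max ρ (1 / 2) with hρ₁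
  have hρ₁0 : 0 < ρ₁ := lt_of_lt_of_le (by norm_num) (le_max_right _ _)
  have hρ₁1 : ρ₁ < 1 := max_lt hρ (by norm_num)
  have hρρ₁ : ρ ≤ ρ₁ := le_max_left _ _
  /- Step 1: the fixed field `M = F̄^N`, finite over `F`. -/
  haveI : IsGalois F (AlgebraicClosure F) := IsAlgClosure.isGalois F _
  set NA : Subgroup (AlgebraicClosure F ≃ₐ[F] AlgebraicClosure F) :=
    N.comap (absoluteGaloisGroup.toAlgEquiv F).symm.toMonoidHom with hNA_def
  have hmemNA : ∀ g : absoluteGaloisGroup F, absoluteGaloisGroup.toAlgEquiv F g ∈ NA ↔ g ∈ N :=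
    fun g => Iff.rfl
  set M : IntermediateField F (AlgebraicClosure F) := IntermediateField.fixedField NA with hM_def
  have hNAclosed : IsClosed (NA : Set (AlgebraicClosure F ≃ₐ[F] AlgebraicClosure F)) :=
    Subgroup.isClosed_of_isOpen N hNo
  have hGal : M.fixingSubgroup = NA := InfiniteGalois.fixingSubgroup_fixedField ⟨NA, hNAclosed⟩
  have hmemN_of_fix : ∀ g : absoluteGaloisGroup F,
      (∀ x : AlgebraicClosure F, x ∈ M → g • x = x) → g ∈ N := by
    intro g hg
    have h : absoluteGaloisGroup.toAlgEquiv F g ∈ M.fixingSubgroup :=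
      (IntermediateField.mem_fixingSubgroup_iff _ _).2 fun x hx => hg x hx
    rw [hGal] at h
    exact (hmemNA g).1 h
  haveI hMfd : FiniteDimensional F M := (InfiniteGalois.isOpen_iff_finite M).1 (by rw [hGal]; exact hNo)
  /- Step 2: `M` inside the normed closure `F̄`, over `K₀`; its normal closure `E`. -/
  set M' : IntermediateField F (NormedAlgClosure F) :=
    M.map ((NormedAlgClosure.toAlgClosure (F := F)).symm : AlgebraicClosure F →ₐ[F] NormedAlgClosure F)
    with hM'
  haveI hM'fd : FiniteDimensional F M' :=
    LinearEquiv.finiteDimensional (IntermediateField.equivMap M _).toLinearEquiv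
  have hMM' : ∀ x : AlgebraicClosure F, x ∈ M →
      (NormedAlgClosure.toAlgClosure (F := F)).symm x ∈ M' := by
    intro x hx
    rw [hM', IntermediateField.mem_map]
    exact ⟨x, hx, rfl⟩
  haveI : Module.Finite K₀ M' := Module.Finite.trans F M'
  haveI : IsScalarTower K₀ M' (NormedAlgClosure F) := IsScalarTower.of_algebraMap_eq (fun _ => rfl)
  set E : IntermediateField K₀ (NormedAlgClosure F) := normalClosure K₀ M' (NormedAlgClosure F) with hE
  haveI hEfd : FiniteDimensional K₀ E := normalClosure.is_finiteDimensional K₀ M' _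
  haveI hEn : Normal K₀ E := normalClosure.normal K₀ M' _
  have hM'E : ∀ x : NormedAlgClosure F, x ∈ M' → x ∈ E := by
    intro x hx
    have h := AlgHom.fieldRange_le_normalClosure (IsScalarTower.toAlgHom K₀ M' (NormedAlgClosure F))
    exact h ⟨⟨x, hx⟩, rfl⟩
  /- Step 3: an integral primitive element `y₀` of `E`. -/
  obtain ⟨α, hα⟩ := Field.exists_primitive_element K₀ E
  have hEα : E = K₀⟮(α : NormedAlgClosure F)⟯ := by
    have h := IntermediateField.lift_adjoin_simple (K := E) (α := α)
    rw [hα, IntermediateField.lift_top] at h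
    exact h
  obtain ⟨k, hk⟩ := exists_pow_lt_of_lt_one
    (inv_pos.mpr (lt_of_lt_of_le one_pos (le_max_left 1 ‖(α : NormedAlgClosure F)‖))) ht1
  set y₀ : NormedAlgClosure F := algebraMap K₀ (NormedAlgClosure F) ((p : K₀) ^ k) * (α : NormedAlgClosure F)
    with hy₀
  have hy₀1 : ‖y₀‖ ≤ 1 := by
    rw [hy₀, norm_mul, PadicBase.norm_algebraMap_closure, norm_pow]
    have hmax : 0 < max 1 ‖(α : NormedAlgClosure F)‖ := lt_of_lt_of_le one_pos (le_max_left _ _)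
    calc t ^ k * ‖(α : NormedAlgClosure F)‖ ≤ t ^ k * max 1 ‖(α : NormedAlgClosure F)‖ :=
          mul_le_mul_of_nonneg_left (le_max_right _ _) (pow_nonneg ht0.le _)
      _ ≤ (max 1 ‖(α : NormedAlgClosure F)‖)⁻¹ * max 1 ‖(α : NormedAlgClosure F)‖ :=
          mul_le_mul_of_nonneg_right hk.le hmax.le
      _ = 1 := inv_mul_cancel₀ hmax.ne'
  have hy₀E : y₀ ∈ E := E.mul_mem (IntermediateField.algebraMap_mem E _) α.2
  have hpk0 : algebraMap K₀ (NormedAlgClosure F) ((p : K₀) ^ k) ≠ 0 := by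
    rw [map_ne_zero_iff _ (algebraMap K₀ (NormedAlgClosure F)).injective]
    exact pow_ne_zero _ (Nat.cast_ne_zero.mpr hp'.ne_zero)
  -- an element of `G₀` fixing `y₀` fixes `α`, hence `E` pointwise
  have hfixα : ∀ g : BaseGaloisGroup hp, g • y₀ = y₀ → g • (α : NormedAlgClosure F) = α := by
    intro g hg
    rw [hy₀, smul_mul', BaseGaloisGroup.smul_algebraMap hp] at hg
    exact mul_left_cancel₀ hpk0 hg
  /- Step 4: separation constant `J` and degree `D'` of `y₀`. -/
  set f₀ : K₀[X] := minpoly K₀ y₀ with hf₀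
  have hy₀int : IsIntegral K₀ y₀ := Algebra.IsIntegral.isIntegral y₀
  have hf₀0 : f₀ ≠ 0 := minpoly.ne_zero hy₀int
  set Troots : Finset (NormedAlgClosure F) := (f₀.aroots (NormedAlgClosure F)).toFinset with hTroots
  have hTcard : Troots.card ≤ f₀.natDegree := by
    refine (Multiset.toFinset_card_le _).trans ?_
    have h := card_roots' (f₀.map (algebraMap K₀ (NormedAlgClosure F)))
    rwa [natDegree_map] at h
  have hconj : ∀ g : BaseGaloisGroup hp, g • y₀ ∈ Troots := by
    intro g
    rw [hTroots, Multiset.mem_toFinset, mem_aroots]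
    refine ⟨hf₀0, ?_⟩
    rw [BaseGaloisGroup.smul_def, aeval_algHom_apply, hf₀, minpoly.aeval, map_zero]
  set T' : Finset (NormedAlgClosure F) := Troots.erase y₀ with hT'
  set J₀ : ℝ := if h : T'.Nonempty then T'.inf' h (fun r => ‖r - y₀‖) else 1 with hJ₀
  set J : ℝ := min J₀ 1 with hJdef
  have hJ₀pos : 0 < J₀ := by
    rw [hJ₀]
    split_ifs with h
    · rw [Finset.lt_inf'_iff]
      intro r hr
      rw [norm_pos_iff, sub_ne_zero]
      exact (Finset.mem_erase.mp hr).1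
    · exact one_pos
  have hJ0 : 0 < J := lt_min hJ₀pos one_pos
  have hJ1 : J ≤ 1 := min_le_right _ _
  have hJroot : ∀ r ∈ Troots, r ≠ y₀ → J ≤ ‖r - y₀‖ := by
    intro r hr hne
    have hrT' : r ∈ T' := Finset.mem_erase.mpr ⟨hne, hr⟩
    have hne' : T'.Nonempty := ⟨r, hrT'⟩
    refine (min_le_left _ _).trans ?_
    rw [hJ₀, dif_pos hne']
    exact Finset.inf'_le _ hrT'
  set D' : ℕ := f₀.natDegree with hD'
  have hD'pos : 0 < D' := minpoly.natDegree_pos hy₀int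
  /- Step 5: the depth `m` and the level `n`. -/
  obtain ⟨m₁, hm₁⟩ := exists_pow_lt_of_lt_one (pow_pos hJ0 D') ht1
  set m : ℕ := m₁ + 1 with hmdef
  have hm1 : 1 ≤ m := by omega
  have hsmall : t ^ (m - 1) < J ^ D' := by rw [hmdef, Nat.add_sub_cancel]; exact hm₁
  obtain ⟨q, hq⟩ := exists_pow_lt_of_lt_one ht0 hρ₁1
  set e : ℕ := D' + p + 1 with hedef
  set n : ℕ := m + e * q + 3 with hndef
  have hn1 : 1 ≤ n := by omega
  have hn3 : 3 ≤ n := by omega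
  have hmn : m + 1 ≤ n := by omega
  have hnm1 : 1 ≤ n - m := by omega
  /- Step 6: the layer `Ω = E(ζ_{p^n})`. -/
  haveI : FiniteDimensional K₀ (K hp n) := by
    rw [K_def]; exact adjoin.finiteDimensional (Algebra.IsIntegral.isIntegral _)
  haveI : Normal K₀ (K hp n) := by
    haveI : NeZero (p ^ n) := ⟨pow_ne_zero _ hp'.ne_zero⟩
    haveI := (zeta_spec F p n).intermediateField_adjoin_isCyclotomicExtension K₀
    rw [K_def]
    exact (IsCyclotomicExtension.isGalois {p ^ n} K₀ K₀⟮zeta F p n⟯).to_normal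
  set Ω : IntermediateField K₀ (NormedAlgClosure F) := E ⊔ K hp n with hΩ
  haveI hΩfd : FiniteDimensional K₀ Ω := by rw [hΩ]; infer_instance
  haveI hΩn : Normal K₀ Ω := by rw [hΩ]; infer_instance
  have hEΩ : E ≤ Ω := le_sup_left
  have hKΩ : K hp n ≤ Ω := le_sup_right
  -- fixing `α` and `ζ` means fixing `Ω` pointwise
  have hΩfix : ∀ g : BaseGaloisGroup hp, g • (α : NormedAlgClosure F) = α → g • zeta F p n = zeta F p n →
      ∀ z : NormedAlgClosure F, z ∈ Ω → g • z = z := by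
    intro g hgα hgζ z hz
    set Hg : Subgroup (BaseGaloisGroup hp) :=
      MulAction.stabilizer (BaseGaloisGroup hp) (α : NormedAlgClosure F) ⊓
        MulAction.stabilizer (BaseGaloisGroup hp) (zeta F p n) with hHg
    have hle : Ω ≤ IntermediateField.fixedField Hg := by
      rw [hΩ, hEα, K_def]
      refine sup_le (adjoin_simple_le_iff.mpr ?_) (adjoin_simple_le_iff.mpr ?_)
      · rw [IntermediateField.mem_fixedField_iff]
        intro f hf
        exact (MulAction.mem_stabilizer_iff.mp (Subgroup.mem_inf.mp hf).1)
      · rw [IntermediateField.mem_fixedField_iff]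
        intro f hf
        exact (MulAction.mem_stabilizer_iff.mp (Subgroup.mem_inf.mp hf).2)
    have hz' := hle hz
    rw [IntermediateField.mem_fixedField_iff] at hz'
    exact hz' g (Subgroup.mem_inf.mpr ⟨hgα, hgζ⟩)
  /- Step 7: the data of the layer theorem. -/
  obtain ⟨x, hx1, hgen⟩ := exists_integral_generator hp Ω
  have hfree : ∀ g : Ω ≃ₐ[K₀] Ω, g x = x → g = 1 := fun g hg => eq_one_of_apply_generator_eq hp Ω hgen g hg
  set y₀Ω : Ω := ⟨y₀, hEΩ hy₀E⟩ with hy₀Ω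
  obtain ⟨P, hP, hPy⟩ := hgen y₀Ω hy₀1
  set ζΩ : Ω := ⟨zeta F p n, hKΩ (zeta_mem_K hp n)⟩ with hζΩ
  have hζ : (ζΩ : NormedAlgClosure F) = zeta F p n := rfl
  obtain ⟨C, hC⟩ : ∃ C : Subgroup (Ω ≃ₐ[K₀] Ω), ∀ g, g ∈ C ↔ g y₀Ω = y₀Ω :=
    ⟨MulAction.stabilizer _ y₀Ω, fun g => MulAction.mem_stabilizer_iff⟩
  obtain ⟨H, hH⟩ : ∃ H : Subgroup (Ω ≃ₐ[K₀] Ω), ∀ g, g ∈ H ↔ g ζΩ = ζΩ :=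
    ⟨MulAction.stabilizer _ ζΩ, fun g => MulAction.mem_stabilizer_iff⟩
  -- `H ∩ C = 1`
  have hHC : ∀ g : Ω ≃ₐ[K₀] Ω, g ζΩ = ζΩ → g y₀Ω = y₀Ω → g = 1 := by
    intro g hgζ hgy
    obtain ⟨g₀, hg₀⟩ := exists_base_forall_coe_eq hp Ω g
    have h1 : g₀ • y₀ = y₀ := by
      have := congrArg (fun z : Ω => (z : NormedAlgClosure F)) hgy
      simpa only [hg₀] using this
    have h2 : g₀ • zeta F p n = zeta F p n := by
      have := congrArg (fun z : Ω => (z : NormedAlgClosure F)) hgζ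
      simpa only [hg₀] using this
    ext z
    exact_mod_cast (hg₀ z).trans (hΩfix g₀ (hfixα g₀ h1) h2 z z.2)
  -- separation
  have hJ : ∀ σ : Ω ≃ₐ[K₀] Ω, σ y₀Ω ≠ y₀Ω →
      J ≤ ‖((σ y₀Ω : Ω) : NormedAlgClosure F) - y₀Ω‖ := by
    intro σ hσ
    obtain ⟨g₀, hg₀⟩ := exists_base_forall_coe_eq hp Ω σ
    rw [hg₀]
    refine hJroot _ (hconj g₀) fun h => hσ ?_
    apply Subtype.ext
    rw [hg₀]; exact h
  -- `[G : C] ≤ D'`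
  have hD'le : Fintype.card ((Ω ≃ₐ[K₀] Ω) ⧸ C) ≤ D' := by
    rw [← Finset.card_univ]
    refine (Finset.card_le_card_of_injOn
      (fun qC : (Ω ≃ₐ[K₀] Ω) ⧸ C => ((qC.out y₀Ω : Ω) : NormedAlgClosure F)) (fun qC _ => ?_) ?_).trans hTcard
    · obtain ⟨g₀, hg₀⟩ := exists_base_forall_coe_eq hp Ω qC.out
      change ((qC.out y₀Ω : Ω) : NormedAlgClosure F) ∈ (Troots : Set (NormedAlgClosure F))
      rw [Finset.mem_coe, hg₀]
      exact hconj g₀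
    · intro q₁ _ q₂ _ h12
      have h1 : q₁.out y₀Ω = q₂.out y₀Ω := Subtype.ext h12
      have hmem : (q₁.out)⁻¹ * q₂.out ∈ C := by
        rw [hC, AlgEquiv.mul_apply, ← h1, ← AlgEquiv.mul_apply, inv_mul_cancel, AlgEquiv.one_apply]
      have := QuotientGroup.eq.mpr hmem
      rwa [QuotientGroup.out_eq', QuotientGroup.out_eq'] at this
  -- `|H| ≤ D'`
  have hcardH : Fintype.card H ≤ D' := by
    refine (Fintype.card_le_of_injective (fun h : H => (QuotientGroup.mk (h : Ω ≃ₐ[K₀] Ω) :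
      (Ω ≃ₐ[K₀] Ω) ⧸ C)) fun h₁ h₂ h12 => ?_).trans hD'le
    have hmem := QuotientGroup.eq.mp h12
    have hH' : ((h₁ : Ω ≃ₐ[K₀] Ω))⁻¹ * h₂ ∈ H := H.mul_mem (H.inv_mem h₁.2) h₂.2
    have h1 := hHC _ ((hH _).mp hH') ((hC _).mp hmem)
    rw [inv_mul_eq_one] at h1
    exact Subtype.ext h1
  have hsmall' : ‖(p : PadicBase F p hp)‖ ^ (m - 1) < J ^ D' := hsmall
  /- Step 8: the subgroups `A = r(Γ')`, `B = r(N ∩ Γ')` of `Gal(Ω/K₀)`. -/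
  set r : absoluteGaloisGroup F →* (Ω ≃ₐ[K₀] Ω) :=
    (AlgEquiv.restrictNormalHom Ω).comp (BaseGaloisGroup.toBase hp) with hrdef
  have hr : ∀ (σ : absoluteGaloisGroup F) (z : Ω),
      (((r σ) z : Ω) : NormedAlgClosure F) = BaseGaloisGroup.toBase hp σ • (z : NormedAlgClosure F) :=
    fun σ z => AlgEquiv.restrictNormalHom_apply Ω (BaseGaloisGroup.toBase hp σ) z
  obtain ⟨A, hAdef⟩ : ∃ A : Subgroup (Ω ≃ₐ[K₀] Ω), A = GF.map r := ⟨_, rfl⟩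
  obtain ⟨B, hBdef⟩ : ∃ B : Subgroup (Ω ≃ₐ[K₀] Ω), B = (N ⊓ GF).map r := ⟨_, rfl⟩
  have hBA : B ≤ A := by rw [hAdef, hBdef]; exact Subgroup.map_mono inf_le_right
  have hA : ∀ a ∈ A, ∃ g : BaseGaloisGroup hp, IsOfFinOrder (baseCyclotomicCharacter hp g) ∧
      ∀ z : Ω, ((a z : Ω) : NormedAlgClosure F) = g • (z : NormedAlgClosure F) := by
    intro a ha
    rw [hAdef, Subgroup.mem_map] at ha
    obtain ⟨σ, hσ, rfl⟩ := ha
    exact ⟨BaseGaloisGroup.toBase hp σ, (hGF σ).mp hσ, hr σ⟩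
  have hodd : p ≠ 2 → ¬ p ∣ Fintype.card (A ⧸ (A ⊓ H).subgroupOf A) :=
    fun hp2 => not_dvd_card_quotient_inf_of_torsion hp Ω hp2 hζ A H hH hA
  have htwo : p = 2 → ∀ a ∈ A, a ζΩ = ζΩ ∨ a ζΩ = ζΩ⁻¹ :=
    fun hp2 => zeta_dichotomy_of_torsion hp Ω hp2 hn1 hζ A hA
  /- Step 9: the multiplier `λ`. -/
  set U : ℝ := ‖zeta F p (n - m) - 1‖ with hU
  have hU0 : 0 < U := norm_zeta_sub_one_pos hnm1
  have hU1 : U < 1 := norm_zeta_sub_one_lt_one hp hnm1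
  have hβ0 : 0 < U ^ D' := pow_pos hU0 _
  have hβ1 : U ^ D' < 1 := pow_lt_one₀ hU0.le hU1 hD'pos.ne'
  obtain ⟨lam, hlamA, hlamle, hlamgt⟩ := exists_fixed_norm_between hp Ω hn1 hζ A H hH hA hβ0 hβ1
  have hlam : ‖(lam : NormedAlgClosure F)‖ ≤ ‖zeta F p (n - m) - 1‖ ^ (Fintype.card H - 1) :=
    hlamle.trans (pow_le_pow_of_le_one hU0.le hU1.le (by omega))
  /- Step 10: the layer theorem. -/
  obtain ⟨Y, hY1, hYB, hYsum⟩ := exists_integral_fixed_norm_orbitSum_ge hp Ω hx1 hfree P hP hPy C hC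
    hn3 hζ H hH hHC hJ0.le hJ1 hJ hD'le hm1 hmn hsmall' A B hBA hodd htwo hlamA hlam
  refine ⟨(Y : NormedAlgClosure F), hY1, ?_, ?_⟩
  · -- fixed by `N ∩ Γ'`
    intro u hu
    have hruB : r u ∈ B := by rw [hBdef]; exact Subgroup.mem_map_of_mem r hu
    rw [← BaseGaloisGroup.toBase_smul hp, ← hr u Y, hYB _ hruB]
  · -- the trace
    have hker : ∀ u ∈ GF, r u = 1 → u ∈ N := by
      intro u _ hru
      apply hmemN_of_fix
      intro z hz
      have hzΩ : (z : NormedAlgClosure F) ∈ Ω := hEΩ (hM'E z (hMM' z hz))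
      have h := hr u ⟨z, hzΩ⟩
      rw [hru, AlgEquiv.one_apply] at h
      exact h.symm
    have hsum : ∑ qN : GF ⧸ N.subgroupOf GF, ((qN.out : GF) : absoluteGaloisGroup F) • (Y : NormedAlgClosure F) =
        ((∑ s : A ⧸ B.subgroupOf A, ((s.out : A) : Ω ≃ₐ[K₀] Ω) Y : Ω) : NormedAlgClosure F) := by
      rw [IntermediateField.coe_sum]
      have h1 : ∀ qN : GF ⧸ N.subgroupOf GF,
          ((qN.out : GF) : absoluteGaloisGroup F) • (Y : NormedAlgClosure F) =
            (((r ((qN.out : GF) : absoluteGaloisGroup F)) Y : Ω) : NormedAlgClosure F) := by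
        intro qN
        rw [hr, BaseGaloisGroup.toBase_smul]
      simp_rw [h1]
      exact sum_quotient_eq_sum_quotient_map r GF N A B hAdef hBdef hker
        (fun g : Ω ≃ₐ[K₀] Ω => ((g Y : Ω) : NormedAlgClosure F))
        (fun b hb g => by simp only [AlgEquiv.mul_apply, hYB b hb])
    rw [hsum]
    refine lt_of_lt_of_le (lt_of_le_of_lt hρρ₁ ?_) hYsum
    -- `ρ₁ < ‖λ‖ · ‖ζ_{p^{n-1}} - 1‖`
    have hUn : U ≤ ‖zeta F p n - 1‖ := norm_zeta_sub_one_mono (by omega)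
    have hUn1 : U ≤ ‖zeta F p (n - 1) - 1‖ := norm_zeta_sub_one_mono (by omega)
    have hUe : ρ₁ < U ^ e := by
      have hpow : t ≤ (U ^ e) ^ q := by
        rw [← pow_mul]
        have hφ : e * q ≤ (p ^ (n - m)).totient :=
          le_trans (by rw [hndef]; omega) (le_totient_prime_pow (p := p) (n - m))
        calc t = U ^ (p ^ (n - m)).totient := by
              rw [hU, norm_zeta_sub_one_pow hnm1, PadicBase.norm_natCast_closure]
          _ ≤ U ^ (e * q) := pow_le_pow_of_le_one hU0.le hU1.le hφ
      have hlt : ρ₁ ^ q < (U ^ e) ^ q := lt_of_lt_of_le hq hpow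
      exact lt_of_pow_lt_pow_left₀ q (pow_nonneg hU0.le _) hlt
    calc ρ₁ < U ^ e := hUe
      _ = U ^ D' * U ^ p * U := by rw [hedef, pow_add, pow_add, pow_one]
      _ ≤ U ^ D' * ‖zeta F p n - 1‖ ^ p * ‖zeta F p (n - 1) - 1‖ := by
          apply mul_le_mul _ hUn1 hU0.le (mul_nonneg hβ0.le (pow_nonneg (norm_nonneg _) _))
          exact mul_le_mul_of_nonneg_left (pow_le_pow_left₀ hU0.le hUn p) hβ0.le
      _ ≤ ‖(lam : NormedAlgClosure F)‖ * ‖zeta F p (n - 1) - 1‖ :=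
          mul_le_mul_of_nonneg_right hlamgt.le (norm_nonneg _)

end Literature.NumberTheory.PAdicHodge.TateAlmostEtale
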